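import Summits.CriticalPhenomena.PercolationContinuityZ3.Theorems.PercNearOneGluingNoHeavyLowerTailCILPeeling
import Summits.CriticalPhenomena.PercolationContinuityZ3.Theorems.PercNearOneGluingNoHeavyLowerTailChampionStability
import HarnessLib

/-!
# `NoHeavyLowerTail` (stmt-CriticalPhenomena-4575) — edge raising for set-champion stability ("Prop B")

Support file (prover `prim-gen-induct`, blob-quotient / cumulative-isolation line; `--supports
stmt-CriticalPhenomena-4575`).  No definitions, no named facts, no sorries.

Notation as in `…CILPeeling`: `μ_w = prodBernoulli w`, relays `A`, level `j`, `π(S)` = relays joined to some vertex of `S`,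
and `CS_w(S, c) : μ_w(c ↮ S, 1 ≤ |π(S)| ≤ j) ≤ μ_w(c ↮ S, |π(c)| ≤ j)` (spelling of
`Literature.….observerSet_le_of_lonelier`).

RAISING ONE EDGE AT THE OBSERVER SET.  Let `e = s(v,y)` with `v ∈ S`, `y ∉ S`, and `w₀ = w[e ↦ 0]`.  By the one-bond
decomposition (`stub_oneBondDecomp_k15`) and the gluing lemmas of the champion-stability file
(`ChampionStability.reachable_insert_iff`, `real_update_one_eq`): on `{e open}` the cluster of `S` is the cluster of
`S ∪ {y}` computed without `e`, `c ↮ S` iff `c ↮ S ∪ {y}`, and then `π(c)` is unchanged.  Hence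

* `setCS_raise_edge` — `CS_{w₀}(S, c)` and `CS_{w₀}(S ∪ {y}, c)` imply `CS_w(S, c)` (`y ≠ c`);
  `setCS_raise_edge_witness` — if `y = c` then `CS_{w₀}(S, c)` alone implies `CS_w(S, c)`.
* `setCS_of_subgraph` (**edge raising, iterated**) — let `F` be a finite set of pairs each of the form `s(v,y)` with
  `v ∈ S`, and `w^F = w` off `F`, `0` on `F`.  If `CS_{w^F}(T, c)` holds for EVERY finite `T ⊇ S` with `c ∉ T`, then
  `CS_w(T, c)` holds for every such `T` — in particular `CS_w(S, c)`.

CONSEQUENCE (the induction engine of the line; crux notes BLOBQUOTIENT.md §10).  Take `c` = a level-`j` champion of the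
smaller weighted graph `w^F` (`F ≠ ∅`).  For `T ⊇ S` containing a relay `a` the hypothesis `CS_{w^F}(T, c)` is the
lonely-cluster exchange (`observerSet_le_of_lonelier`, as `μ_{w^F}{|π(a)| ≤ j} ≤ μ_{w^F}{|π(c)| ≤ j}`); for `T` made of
non-relays it is set-champion stability with the PLAIN champion in a graph with FEWER positive-weight pairs.  So plain
set-champion stability below `w` yields `CS_w(S, c_F)` for every nonempty `F ⊆ E_S` and every champion `c_F` of `w^F`;
the crux's CIL follows for `S = {o}` (`cil_of_setCS_singleton`), and plain `CS_w(S, champ(w))` for `|S| ≥ 2` follows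
whenever some such `c_F` is no lighter than `champ(w)` in the `S`-glued graph — the "(ML)" condition of the crux notes:
automatic for `|S| = 1` and for an adjacent pair `S` (affinity of the lightness in the inner pair's weight), no failure found
for LIGHT sets `S` (all members lighter than the champion; other sets are covered by `observerSet_le_of_lonelier`) in the
exact census, and genuinely false without the lightness restriction.  It is the one remaining step of an induction on the
number of positive-weight pairs.
-/

noncomputable section

namespace Summit.CriticalPhenomena.PercolationContinuityZ3.Theorems

open MeasureTheory Set Literature.Probability.LatticeModels Literature.Probability.Percolation
open scoped Classical BigOperators

variable {n : ℕ}

namespace CutObserver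

open ChampionStability

/-- After opening `s(v,y)` with `v ∈ S`: `c` is separated from `S` iff it was separated from `S ∪ {y}`. [folklore] -/
theorem forall_not_reachable_insert_iff (ω : BondConfig (Fin n)) {v y c : Fin n} {S : Finset (Fin n)}
    (hvy : v ≠ y) (hvS : v ∈ S) :
    (∀ x ∈ S, ¬ (openGraph (insert s(v, y) ω)).Reachable c x) ↔
      ∀ x ∈ insert y S, ¬ (openGraph ω).Reachable c x := by
  constructor
  · intro h x hx hcx
    rcases Finset.mem_insert.1 hx with rfl | hxS
    · -- `c ↔ y`: then `c ↔' v ∈ S`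
      refine h v hvS ((reachable_insert_iff ω hvy c v).2 (Or.inr ⟨⟨x, by simp, hcx⟩, ⟨v, by simp, SimpleGraph.Reachable.refl _⟩⟩))
    · exact h x hxS ((reachable_insert_iff ω hvy c x).2 (Or.inl hcx))
  · intro h x hxS hcx
    rcases (reachable_insert_iff ω hvy c x).1 hcx with h1 | ⟨⟨s, hs, hcs⟩, -⟩
    · exact h x (Finset.mem_insert_of_mem hxS) h1
    · simp only [Finset.mem_insert, Finset.mem_singleton] at hs
      rcases hs with rfl | rfl
      · exact h s (Finset.mem_insert_of_mem hvS) hcs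
      · exact h s (Finset.mem_insert_self _ _) hcs

/-- After opening `s(v,y)` with `v ∈ S`: a vertex is joined to some vertex of `S` iff it was joined to some vertex of
`S ∪ {y}`. [folklore] -/
theorem exists_reachable_insert_iff (ω : BondConfig (Fin n)) {v y : Fin n} {S : Finset (Fin n)}
    (hvy : v ≠ y) (hvS : v ∈ S) (z : Fin n) :
    (∃ x ∈ S, (openGraph (insert s(v, y) ω)).Reachable x z) ↔
      ∃ x ∈ insert y S, (openGraph ω).Reachable x z := by
  constructor
  · rintro ⟨x, hxS, hxz⟩
    rcases (reachable_insert_iff ω hvy x z).1 hxz with h1 | ⟨-, ⟨s, hs, hsz⟩⟩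
    · exact ⟨x, Finset.mem_insert_of_mem hxS, h1⟩
    · simp only [Finset.mem_insert, Finset.mem_singleton] at hs
      rcases hs with rfl | rfl
      · exact ⟨s, Finset.mem_insert_of_mem hvS, hsz⟩
      · exact ⟨s, Finset.mem_insert_self _ _, hsz⟩
  · rintro ⟨x, hx, hxz⟩
    rcases Finset.mem_insert.1 hx with rfl | hxS
    · -- `y ↔ z`: then `v ↔' z`
      exact ⟨v, hvS, (reachable_insert_iff ω hvy v z).2
        (Or.inr ⟨⟨v, by simp, SimpleGraph.Reachable.refl _⟩, ⟨x, by simp, hxz⟩⟩)⟩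
    · exact ⟨x, hxS, (reachable_insert_iff ω hvy x z).2 (Or.inl hxz)⟩

end CutObserver

open CutObserver ChampionStability in
/-- **Raising one edge at the observer set.**  Let `v ∈ S`, `y ≠ v`, `e = s(v,y)`, `w₀ = w[e ↦ 0]`.  If
`CS_{w₀}(S, c)` and `CS_{w₀}(S ∪ {y}, c)` then `CS_w(S, c)` (for `y ∈ S` the two hypotheses coincide: a pair inside `S`
does not affect the events; for `y = c` the second hypothesis is void, cf. `setCS_raise_edge_witness`).  Proof: one-bond decomposition of both sides of `CS_w(S, c)`
at `e`; on `{e open}` (weights `w₀[e ↦ 1]`, pulled back along `ω ↦ insert e ω`) the two events are exactly the two events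
of `CS_{w₀}(S ∪ {y}, c)` (`CutObserver.forall_not_reachable_insert_iff`, `exists_reachable_insert_iff`, and
`reachable_insert_iff_of_not` for `π(c)`). [folklore] -/
theorem setCS_raise_edge (w : Sym2 (Fin n) → unitInterval) (A S : Finset (Fin n)) (v y c : Fin n) (j : ℕ)
    (hvS : v ∈ S) (hvy : v ≠ y)
    (h₀ : (prodBernoulli (Function.update w s(v, y) 0)).real {ω : BondConfig (Fin n) |
        (∀ x ∈ S, ω ∉ openConn c x) ∧ 1 ≤ (A.filter fun z => ∃ x ∈ S, ω ∈ openConn x z).card ∧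
        (A.filter fun z => ∃ x ∈ S, ω ∈ openConn x z).card ≤ j} ≤
      (prodBernoulli (Function.update w s(v, y) 0)).real {ω : BondConfig (Fin n) |
        (∀ x ∈ S, ω ∉ openConn c x) ∧ (A.filter fun z => ω ∈ openConn c z).card ≤ j})
    (h₁ : (prodBernoulli (Function.update w s(v, y) 0)).real {ω : BondConfig (Fin n) |
        (∀ x ∈ insert y S, ω ∉ openConn c x) ∧ 1 ≤ (A.filter fun z => ∃ x ∈ insert y S, ω ∈ openConn x z).card ∧
        (A.filter fun z => ∃ x ∈ insert y S, ω ∈ openConn x z).card ≤ j} ≤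
      (prodBernoulli (Function.update w s(v, y) 0)).real {ω : BondConfig (Fin n) |
        (∀ x ∈ insert y S, ω ∉ openConn c x) ∧ (A.filter fun z => ω ∈ openConn c z).card ≤ j}) :
    (prodBernoulli w).real {ω : BondConfig (Fin n) |
        (∀ x ∈ S, ω ∉ openConn c x) ∧ 1 ≤ (A.filter fun z => ∃ x ∈ S, ω ∈ openConn x z).card ∧
        (A.filter fun z => ∃ x ∈ S, ω ∈ openConn x z).card ≤ j} ≤
      (prodBernoulli w).real {ω : BondConfig (Fin n) |
        (∀ x ∈ S, ω ∉ openConn c x) ∧ (A.filter fun z => ω ∈ openConn c z).card ≤ j} := by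
  set e : Sym2 (Fin n) := s(v, y) with he
  set w₀ := Function.update w e 0 with hw₀
  set LS := {ω : BondConfig (Fin n) |
    (∀ x ∈ S, ω ∉ openConn c x) ∧ 1 ≤ (A.filter fun z => ∃ x ∈ S, ω ∈ openConn x z).card ∧
    (A.filter fun z => ∃ x ∈ S, ω ∈ openConn x z).card ≤ j} with hLS
  set RS := {ω : BondConfig (Fin n) |
    (∀ x ∈ S, ω ∉ openConn c x) ∧ (A.filter fun z => ω ∈ openConn c z).card ≤ j} with hRS
  set LSy := {ω : BondConfig (Fin n) |
    (∀ x ∈ insert y S, ω ∉ openConn c x) ∧ 1 ≤ (A.filter fun z => ∃ x ∈ insert y S, ω ∈ openConn x z).card ∧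
    (A.filter fun z => ∃ x ∈ insert y S, ω ∈ openConn x z).card ≤ j} with hLSy
  set RSy := {ω : BondConfig (Fin n) |
    (∀ x ∈ insert y S, ω ∉ openConn c x) ∧ (A.filter fun z => ω ∈ openConn c z).card ≤ j} with hRSy
  have hw₀e : w₀ s(v, y) = 0 := by simp [hw₀, he]
  have hw₁ : Function.update w e 1 = Function.update w₀ s(v, y) 1 := by
    rw [hw₀, he, Function.update_idem]
  -- the pulled-back events
  have hfilt : ∀ ω : BondConfig (Fin n),
      (A.filter fun z => ∃ x ∈ S, insert s(v, y) ω ∈ openConn x z) =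
        (A.filter fun z => ∃ x ∈ insert y S, ω ∈ openConn x z) := by
    intro ω
    exact Finset.filter_congr fun z _ => exists_reachable_insert_iff ω hvy hvS z
  have hfiltc : ∀ ω : BondConfig (Fin n), (∀ x ∈ insert y S, ω ∉ openConn c x) →
      (A.filter fun z => insert s(v, y) ω ∈ openConn c z) = (A.filter fun z => ω ∈ openConn c z) := by
    intro ω h
    have hcv : ¬ (openGraph ω).Reachable c v := h v (Finset.mem_insert_of_mem hvS)
    have hcy : ¬ (openGraph ω).Reachable c y := h y (Finset.mem_insert_self _ _)
    exact Finset.filter_congr fun z _ => reachable_insert_iff_of_not ω hvy hcv hcy z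
  have hpreL : (fun ω : BondConfig (Fin n) => insert s(v, y) ω) ⁻¹' LS = LSy := by
    ext ω
    simp only [hLS, hLSy, mem_preimage, mem_setOf_eq]
    rw [hfilt ω]
    constructor
    · rintro ⟨hsep, h1, h2⟩
      exact ⟨(forall_not_reachable_insert_iff ω hvy hvS).1 hsep, h1, h2⟩
    · rintro ⟨hsep, h1, h2⟩
      exact ⟨(forall_not_reachable_insert_iff ω hvy hvS).2 hsep, h1, h2⟩
  have hpreR : (fun ω : BondConfig (Fin n) => insert s(v, y) ω) ⁻¹' RS = RSy := by
    ext ω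
    simp only [hRS, hRSy, mem_preimage, mem_setOf_eq]
    constructor
    · rintro ⟨hsep, h2⟩
      have hsep' := (forall_not_reachable_insert_iff ω hvy hvS).1 hsep
      refine ⟨hsep', ?_⟩
      rw [← hfiltc ω hsep']; exact h2
    · rintro ⟨hsep, h2⟩
      refine ⟨(forall_not_reachable_insert_iff ω hvy hvS).2 hsep, ?_⟩
      rw [hfiltc ω hsep]; exact h2
  have hL1 : (prodBernoulli (Function.update w e 1)).real LS = (prodBernoulli w₀).real LSy := by
    rw [hw₁, real_update_one_eq w₀ hw₀e LS, hpreL]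
  have hR1 : (prodBernoulli (Function.update w e 1)).real RS = (prodBernoulli w₀).real RSy := by
    rw [hw₁, real_update_one_eq w₀ hw₀e RS, hpreR]
  have hp0 : 0 ≤ (w e : ℝ) := (w e).2.1
  have hp1 : (w e : ℝ) ≤ 1 := (w e).2.2
  rw [stub_oneBondDecomp_k15 n w e LS, stub_oneBondDecomp_k15 n w e RS, hL1, hR1]
  have ha : (1 - (w e : ℝ)) * (prodBernoulli w₀).real LS ≤ (1 - (w e : ℝ)) * (prodBernoulli w₀).real RS :=
    mul_le_mul_of_nonneg_left h₀ (by linarith)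
  have hb : (w e : ℝ) * (prodBernoulli w₀).real LSy ≤ (w e : ℝ) * (prodBernoulli w₀).real RSy :=
    mul_le_mul_of_nonneg_left h₁ hp0
  exact add_le_add ha hb

open CutObserver ChampionStability in
/-- **Raising the edge to the witness.**  Let `v ∈ S`, `c ∉ S`, `e = s(v,c)`, `w₀ = w[e ↦ 0]`.  If `CS_{w₀}(S, c)` then
`CS_w(S, c)`: on `{e open}` the witness `c` is joined to `v ∈ S`, so both events of `CS_w(S, c)` are empty there. [folklore] -/
theorem setCS_raise_edge_witness (w : Sym2 (Fin n) → unitInterval) (A S : Finset (Fin n)) (v c : Fin n) (j : ℕ)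
    (hvS : v ∈ S) (hcS : c ∉ S)
    (h₀ : (prodBernoulli (Function.update w s(v, c) 0)).real {ω : BondConfig (Fin n) |
        (∀ x ∈ S, ω ∉ openConn c x) ∧ 1 ≤ (A.filter fun z => ∃ x ∈ S, ω ∈ openConn x z).card ∧
        (A.filter fun z => ∃ x ∈ S, ω ∈ openConn x z).card ≤ j} ≤
      (prodBernoulli (Function.update w s(v, c) 0)).real {ω : BondConfig (Fin n) |
        (∀ x ∈ S, ω ∉ openConn c x) ∧ (A.filter fun z => ω ∈ openConn c z).card ≤ j}) :
    (prodBernoulli w).real {ω : BondConfig (Fin n) |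
        (∀ x ∈ S, ω ∉ openConn c x) ∧ 1 ≤ (A.filter fun z => ∃ x ∈ S, ω ∈ openConn x z).card ∧
        (A.filter fun z => ∃ x ∈ S, ω ∈ openConn x z).card ≤ j} ≤
      (prodBernoulli w).real {ω : BondConfig (Fin n) |
        (∀ x ∈ S, ω ∉ openConn c x) ∧ (A.filter fun z => ω ∈ openConn c z).card ≤ j} := by
  set e : Sym2 (Fin n) := s(v, c) with he
  set w₀ := Function.update w e 0 with hw₀
  set LS := {ω : BondConfig (Fin n) |
    (∀ x ∈ S, ω ∉ openConn c x) ∧ 1 ≤ (A.filter fun z => ∃ x ∈ S, ω ∈ openConn x z).card ∧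
    (A.filter fun z => ∃ x ∈ S, ω ∈ openConn x z).card ≤ j} with hLS
  set RS := {ω : BondConfig (Fin n) |
    (∀ x ∈ S, ω ∉ openConn c x) ∧ (A.filter fun z => ω ∈ openConn c z).card ≤ j} with hRS
  have hvc : v ≠ c := fun h => hcS (h ▸ hvS)
  have hw₀e : w₀ s(v, c) = 0 := by simp [hw₀, he]
  have hw₁ : Function.update w e 1 = Function.update w₀ s(v, c) 1 := by
    rw [hw₀, he, Function.update_idem]
  have hreach : ∀ ω : BondConfig (Fin n), (openGraph (insert s(v, c) ω)).Reachable c v := by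
    intro ω
    have hadj : (openGraph (insert s(v, c) ω)).Adj c v := by
      rw [openGraph_adj, Sym2.eq_swap]; exact ⟨Set.mem_insert _ _, hvc.symm⟩
    exact hadj.reachable
  have hpreL : (fun ω : BondConfig (Fin n) => insert s(v, c) ω) ⁻¹' LS = ∅ := by
    ext ω
    simp only [hLS, mem_preimage, mem_setOf_eq, mem_empty_iff_false, iff_false, not_and]
    intro hsep; exact absurd (hreach ω) (hsep v hvS)
  have hpreR : (fun ω : BondConfig (Fin n) => insert s(v, c) ω) ⁻¹' RS = ∅ := by
    ext ω
    simp only [hRS, mem_preimage, mem_setOf_eq, mem_empty_iff_false, iff_false, not_and]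
    intro hsep; exact absurd (hreach ω) (hsep v hvS)
  have hL1 : (prodBernoulli (Function.update w e 1)).real LS = 0 := by
    rw [hw₁, real_update_one_eq w₀ hw₀e LS, hpreL, measureReal_empty]
  have hR1 : (prodBernoulli (Function.update w e 1)).real RS = 0 := by
    rw [hw₁, real_update_one_eq w₀ hw₀e RS, hpreR, measureReal_empty]
  have hp1 : (w e : ℝ) ≤ 1 := (w e).2.2
  rw [stub_oneBondDecomp_k15 n w e LS, stub_oneBondDecomp_k15 n w e RS, hL1, hR1, mul_zero, add_zero, add_zero]
  exact mul_le_mul_of_nonneg_left h₀ (by linarith)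

open CutObserver ChampionStability in
/-- **Edge raising, iterated ("Prop B" of the line).**  Let `S` be a finite vertex set, `c ∉ S`, and `F` a finite set of
pairs each of the form `s(v,y)` with `v ∈ S`, `y ≠ v` (pairs at `S`, inner pairs allowed); let `w^F` be `w` with the pairs
of `F` switched off.  If `CS_{w^F}(T, c)` holds for every finite `T ⊇ S` with `c ∉ T`, then `CS_w(T, c)` holds for every such
`T`.  Induction on `F`, raising one pair at a time (`setCS_raise_edge` with the observer sets `T` and `T ∪ {y}`, or
`setCS_raise_edge_witness` when `y = c`). [folklore] -/
theorem setCS_of_subgraph (A S : Finset (Fin n)) (c : Fin n) (j : ℕ) (hcS : c ∉ S)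
    (F : Finset (Sym2 (Fin n))) (hF : ∀ e ∈ F, ∃ v ∈ S, ∃ y, y ≠ v ∧ e = s(v, y))
    (w : Sym2 (Fin n) → unitInterval)
    (hbase : ∀ T : Finset (Fin n), S ⊆ T → c ∉ T →
      (prodBernoulli (fun e => if e ∈ F then 0 else w e)).real {ω : BondConfig (Fin n) |
          (∀ x ∈ T, ω ∉ openConn c x) ∧ 1 ≤ (A.filter fun z => ∃ x ∈ T, ω ∈ openConn x z).card ∧
          (A.filter fun z => ∃ x ∈ T, ω ∈ openConn x z).card ≤ j} ≤
        (prodBernoulli (fun e => if e ∈ F then 0 else w e)).real {ω : BondConfig (Fin n) |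
          (∀ x ∈ T, ω ∉ openConn c x) ∧ (A.filter fun z => ω ∈ openConn c z).card ≤ j})
    (T : Finset (Fin n)) (hST : S ⊆ T) (hcT : c ∉ T) :
    (prodBernoulli w).real {ω : BondConfig (Fin n) |
        (∀ x ∈ T, ω ∉ openConn c x) ∧ 1 ≤ (A.filter fun z => ∃ x ∈ T, ω ∈ openConn x z).card ∧
        (A.filter fun z => ∃ x ∈ T, ω ∈ openConn x z).card ≤ j} ≤
      (prodBernoulli w).real {ω : BondConfig (Fin n) |
        (∀ x ∈ T, ω ∉ openConn c x) ∧ (A.filter fun z => ω ∈ openConn c z).card ≤ j} := by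
  induction F using Finset.induction_on generalizing w T with
  | empty =>
    have hw : (fun e => if e ∈ (∅ : Finset (Sym2 (Fin n))) then (0 : unitInterval) else w e) = w := by
      funext e; simp
    have h := hbase T hST hcT
    rw [hw] at h
    exact h
  | insert e₀ F he₀ ih =>
    obtain ⟨v, hvS, y, hvy, rfl⟩ := hF _ (Finset.mem_insert_self _ _)
    have hF' : ∀ e ∈ F, ∃ v ∈ S, ∃ y, y ≠ v ∧ e = s(v, y) := fun e he => hF e (Finset.mem_insert_of_mem he)
    -- switching off `insert e₀ F` in `w` = switching off `F` in `w[e₀ ↦ 0]`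
    have hfun : (fun e => if e ∈ insert s(v, y) F then (0 : unitInterval) else w e) =
        (fun e => if e ∈ F then (0 : unitInterval) else Function.update w s(v, y) 0 e) := by
      funext e
      by_cases h1 : e = s(v, y)
      · subst h1; simp [he₀]
      · simp [Finset.mem_insert, h1]
    have hbase' : ∀ T : Finset (Fin n), S ⊆ T → c ∉ T →
        (prodBernoulli (fun e => if e ∈ F then 0 else Function.update w s(v, y) 0 e)).real {ω : BondConfig (Fin n) |
            (∀ x ∈ T, ω ∉ openConn c x) ∧ 1 ≤ (A.filter fun z => ∃ x ∈ T, ω ∈ openConn x z).card ∧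
            (A.filter fun z => ∃ x ∈ T, ω ∈ openConn x z).card ≤ j} ≤
          (prodBernoulli (fun e => if e ∈ F then 0 else Function.update w s(v, y) 0 e)).real {ω : BondConfig (Fin n) |
            (∀ x ∈ T, ω ∉ openConn c x) ∧ (A.filter fun z => ω ∈ openConn c z).card ≤ j} := by
      intro T' hST' hcT'
      have h := hbase T' hST' hcT'
      rw [hfun] at h
      exact h
    have hall := ih hF' (Function.update w s(v, y) 0) hbase'
    have hvT : v ∈ T := hST hvS
    by_cases hyc : y = c
    · subst hyc
      exact setCS_raise_edge_witness w A T v y j hvT hcT (hall T hST hcT)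
    · have hcT' : c ∉ insert y T := by
        rw [Finset.mem_insert, not_or]; exact ⟨fun h => hyc h.symm, hcT⟩
      exact setCS_raise_edge w A T v y c j hvT hvy.symm (hall T hST hcT)
        (hall (insert y T) (hST.trans (Finset.subset_insert _ _)) hcT')

end Summit.CriticalPhenomena.PercolationContinuityZ3.Theorems

end
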